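import Literature.NumberTheory.GaloisRepresentations.ContinuousH2
import Literature.NumberTheory.GaloisRepresentations.ContinuousH1OrderTwo
import HarnessLib

/-!
# `H²` of a group of order two with arbitrary action: the class of an inhomogeneous `2`-cocycle is
# determined by `φ(c, c) - c φ(1, 1)` modulo norms `(1 + c) X`

For a group `G = {1, c}` of order two acting on an abelian group `A`, the classical isomorphism
`H²(G, A) ⥲ Ĥ⁰(G, A) = A^G / N_G A` (`N_G = 1 + c`) reads, on a (not necessarily normalised)
inhomogeneous `2`-cocycle `φ`, `[φ] ↦ φ(c, c) - c φ(1, 1) mod (1 + c) A`: subtracting the coboundary of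
the constant cochain `φ(1, 1)` normalises `φ`, and a normalised cocycle of `G` is determined by its
value at `(c, c)`, which is `G`-invariant, two such being cohomologous iff the values differ by a norm
(Serre, *Corps locaux* VIII §4, cohomology of finite cyclic groups; Milne *ADT* I Thm. 2.13 "direct
calculation").  The tree's `GaloisCohomology/ArchimedeanInvariantMap.lean` proves the special case in
which `c` acts as `-1` (coefficients `μₙ`), where `φ(c, c) + φ(1, 1)` serves; this file records the
general-action statements, on Mathlib's continuous cochains (`contTwoCocycles`, `twoCocycleClass`,
file `ContinuousH2.lean`), for a topological group `G` with `|G| ≤ 2` carrying the discrete topology: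

* `twoCocycleNormDiag c φ = φ(c, c) - c φ(1, 1)` (definition with body), additive;
* `rho_twoCocycleNormDiag` — it is `c`-invariant (`c * c = 1`);
* `twoCocycleClass_eq_zero_of_twoCocycleNormDiag_eq` — **if `φ(c, c) - c φ(1, 1) = y + c y` then
  `[φ] = 0`** (explicit coboundary: `b(1) = φ(1,1)`, `b(c) = φ(1,1) + y`);
* `twoCocycleClass_eq_of_twoCocycleNormDiag_sub_eq` — two cocycles whose normalised diagonals differ
  by a norm have the same class.

Consumer: the real-place surjectivity `H²(K, M) ↠ ⊕_{v real} H²(K_v, M)` (Milne I Cor. 4.16) in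
`GaloisCohomology/PoitouTateTwoRealPlacesSurjectiveHolds.lean`, where `G = Γ_{K_w}` has order `2`.

## References

* J.-P. Serre, *Corps locaux* (1968) / *Local Fields* (1979), VIII §4 (cohomology of finite cyclic
  groups, `Ĥ⁰ = A^G/N A ≅ H²`). [SerreLocalFields1979]
* J. S. Milne, *Arithmetic Duality Theorems*, 2nd ed. (2006), I Thm. 2.13 (a) (`G = Gal(ℂ/ℝ)`).
  [MilneADT2006]
-/

noncomputable section

universe u v

namespace Literature.NumberTheory.GaloisRepresentations

open _root_.TopRep

section OrderTwo

variable {R : Type v} [CommRing R] [TopologicalSpace R]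
variable {G : Type u} [Group G] [TopologicalSpace G] [IsTopologicalGroup G]
variable {X : TopRep.{u} R G}

/-- **The normalised diagonal `φ(c, c) - c φ(1, 1)` of an inhomogeneous `2`-cocycle** at the element
`c`: the value at `(c, c)` of the normalised cocycle `φ - d(φ(1,1))`; for `G = {1, c}` it represents the
image of `[φ]` in `Ĥ⁰(G, X) = X^G/(1 + c)X`. [cite: SerreLocalFields1979, VIII §4] -/
def twoCocycleNormDiag (c : G) (φ : contTwoCocycles X) : X :=
  φ.1 (c, c) - X.ρ c (φ.1 (1, 1))

omit [IsTopologicalGroup G] in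
/-- Unfolding `twoCocycleNormDiag`. [cite: SerreLocalFields1979, VIII §4] -/
theorem twoCocycleNormDiag_def (c : G) (φ : contTwoCocycles X) :
    twoCocycleNormDiag c φ = φ.1 (c, c) - X.ρ c (φ.1 (1, 1)) := rfl

omit [IsTopologicalGroup G] in
/-- `twoCocycleNormDiag` is additive. [cite: SerreLocalFields1979, VIII §4] -/
theorem twoCocycleNormDiag_add (c : G) (φ ψ : contTwoCocycles X) :
    twoCocycleNormDiag c (φ + ψ) = twoCocycleNormDiag c φ + twoCocycleNormDiag c ψ := by
  simp only [twoCocycleNormDiag, Submodule.coe_add, ContinuousMap.add_apply, map_add]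
  abel

omit [IsTopologicalGroup G] in
/-- `twoCocycleNormDiag` commutes with subtraction. [cite: SerreLocalFields1979, VIII §4] -/
theorem twoCocycleNormDiag_sub (c : G) (φ ψ : contTwoCocycles X) :
    twoCocycleNormDiag c (φ - ψ) = twoCocycleNormDiag c φ - twoCocycleNormDiag c ψ := by
  rw [eq_sub_iff_add_eq, ← twoCocycleNormDiag_add, sub_add_cancel]

omit [IsTopologicalGroup G] in
/-- **The normalised diagonal is `c`-invariant** for an involution `c` (`c * c = 1`): the cocycle
identity at `(c, c, c)` with `φ(1, c) = φ(1, 1)`, `φ(c, 1) = c φ(1, 1)`; i.e. it lies in `X^G`.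
[cite: SerreLocalFields1979, VIII §4] -/
theorem rho_twoCocycleNormDiag {c : G} (hc : c * c = 1) (φ : contTwoCocycles X) :
    X.ρ c (twoCocycleNormDiag c φ) = twoCocycleNormDiag c φ := by
  have h := φ.2 c c c
  rw [hc, contTwoCocycles.apply_one_left, contTwoCocycles.apply_one_right] at h
  -- h : c φ(c,c) + c φ(1,1) = φ(1,1) + φ(c,c)
  have h1 : X.ρ c (X.ρ c (φ.1 (1, 1))) = φ.1 (1, 1) := by
    rw [← ContinuousLinearMap.comp_apply, ← ContinuousLinearMap.mul_def, ← map_mul, hc, map_one]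
    rfl
  rw [twoCocycleNormDiag, map_sub, h1]
  have h2 : X.ρ c (φ.1 (c, c)) = φ.1 (1, 1) + φ.1 (c, c) - X.ρ c (φ.1 (1, 1)) :=
    eq_sub_of_add_eq h
  rw [h2]
  abel

/-- **Zero criterion**: for `G = {1, c}` of order `≤ 2` (discrete) and `c ≠ 1`, if the normalised
diagonal is a norm, `φ(c, c) - c φ(1, 1) = y + c y`, then `[φ] = 0` — `φ` is the coboundary of the
cochain `b(1) = φ(1, 1)`, `b(c) = φ(1, 1) + y`. [cite: SerreLocalFields1979, VIII §4]
[cite: MilneADT2006, Ch. I, Thm. 2.13] -/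
theorem twoCocycleClass_eq_zero_of_twoCocycleNormDiag_eq [Finite G] [DiscreteTopology G]
    (hG : Nat.card G ≤ 2) {c : G} (hc : c ≠ 1) (φ : contTwoCocycles X) {y : X}
    (h : twoCocycleNormDiag c φ = y + X.ρ c y) : twoCocycleClass X φ = 0 := by
  classical
  have hcc : c * c = 1 := mul_self_eq_one_of_natCard_le_two hG c
  set a : X := φ.1 (1, 1) with ha
  have hφcc : φ.1 (c, c) = y + X.ρ c y + X.ρ c a := by
    rw [← h, twoCocycleNormDiag, sub_add_cancel]
  rw [twoCocycleClass_eq_zero_iff]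
  refine ⟨⟨fun σ => if σ = 1 then a else a + y, continuous_of_discreteTopology⟩, fun σ τ => ?_⟩
  simp only [ContinuousMap.coe_mk]
  have h1 : X.ρ (1 : G) = 1 := map_one X.ρ
  rcases eq_or_ne σ 1 with rfl | hσ
  · -- σ = 1
    rw [contTwoCocycles.apply_one_left, h1, one_mul, if_pos rfl]
    change a = _
    rw [one_apply_eq_self]
    abel
  · obtain rfl : σ = c := eq_of_ne_one_of_natCard_le_two hG hσ hc
    rw [if_neg hσ]
    rcases eq_or_ne τ 1 with rfl | hτ
    · rw [contTwoCocycles.apply_one_right, mul_one, if_pos rfl, if_neg hσ]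
      change X.ρ σ a = _
      abel
    · obtain rfl : τ = σ := eq_of_ne_one_of_natCard_le_two hG hτ hσ
      rw [hcc, if_pos rfl, if_neg hσ, hφcc, map_add]
      abel

/-- **Two cocycles whose normalised diagonals differ by a norm are cohomologous** (`G = {1, c}` of
order `≤ 2`, discrete, `c ≠ 1`). [cite: SerreLocalFields1979, VIII §4] [cite: MilneADT2006, Ch. I, Thm. 2.13] -/
theorem twoCocycleClass_eq_of_twoCocycleNormDiag_sub_eq [Finite G] [DiscreteTopology G]
    (hG : Nat.card G ≤ 2) {c : G} (hc : c ≠ 1) (φ ψ : contTwoCocycles X) {y : X}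
    (h : twoCocycleNormDiag c φ - twoCocycleNormDiag c ψ = y + X.ρ c y) :
    twoCocycleClass X φ = twoCocycleClass X ψ := by
  rw [← sub_eq_zero, ← twoCocycleClass_sub]
  exact twoCocycleClass_eq_zero_of_twoCocycleNormDiag_eq hG hc _ (by rw [twoCocycleNormDiag_sub, h])

end OrderTwo

end Literature.NumberTheory.GaloisRepresentations

end
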